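import Summits.CriticalPhenomena.PercolationContinuityZ3.Theorems.PercNearOneGluingNoHeavyPcintProductResampling
import Summits.CriticalPhenomena.PercolationContinuityZ3.Theorems.PercNearOneGluingNoHeavyPcintVdBEFibreBasic
import Summits.CriticalPhenomena.PercolationContinuityZ3.Theorems.PercNearOneGluingNoHeavyPcintVdBETableBridge
import HarnessLib

/-!
# PCINT lane, king route, K1 step (3b), analytic core: resampling the touched sites

Cell `prim-pcint`, seat `prim-pcint-1` (gen 10); memo `run/shared/lean/prim/pcint/KING-ROUTE.md` §K1 (3).

Generic finite-sum lemmas that turn the fibre factorisation of `…PcintVdBEFibreFactor.lean` into the step-wise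
domination inequality of `AdaptDom.Dominating`:

* `AdaptDom.sum_pw_mixG` — **resampling a set of sites**: `Σ_w pw w · F w = Σ_w pw w · Σ_u pw u · F (mixG W u w)`;
* `AdaptDom.dominance_of_factorisation` — if the fibre indicator factorises under `mixG W` as
  `𝟙[T (mixG W u w)] = 𝟙[Trest w] · 𝟙[Ψ u w]` and the payoff on the fibre depends on `u` only, then per-`w`
  dominance of the `u`-integral gives dominance of the fibre sums;
* `AdaptDom.inner_sum_eq` — the `u`-integral of a product of one-site factors at `b₂`, `c`, the failed brothers and of a
  function of three Boolean reads, computed by resampling `b₂`, `c`, integrating out the failed brothers and taking the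
  joint law of the reads (`sum_pw_read3`): an explicit double sum over the pair states `(α, γ)` of `(b₂, c)`;
* `AdaptDom.xOf` (the canonical configuration with prescribed values at three optional sites) and
  `AdaptDom.sum_wt_eq_sum_pi3` — the `π_q`-expectation of a step test function reading only those sites is the
  `π_q^{⊗3}`-expectation of `g ∘ xOf` (`VdBELocal.pi3`).
-/

namespace Summit.CriticalPhenomena.PercolationContinuityZ3.Theorems.Pcint

namespace AdaptDom

open Finset VdBELocal

variable {V : Type*} [Fintype V] [DecidableEq V] {S : Type*} [Fintype S] [DecidableEq S]

/-! ### Resampling a set of sites -/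

omit [Fintype S] [DecidableEq S] in
/-- Swapping the `W`-coordinates of two assignments preserves the product of their weights. -/
theorem pw_mixG_mul_pw_mixG (m : V → S → ℝ) (W : Finset V) (u w : V → S) :
    pw m (mixG W u w) * pw m (mixG W w u) = pw m u * pw m w := by
  unfold pw
  rw [← Finset.prod_mul_distrib, ← Finset.prod_mul_distrib]
  refine Finset.prod_congr rfl fun v _ => ?_
  by_cases hv : v ∈ W
  · rw [mixG_of_mem hv, mixG_of_mem hv]
  · rw [mixG_of_not_mem hv, mixG_of_not_mem hv, mul_comm]

omit [Fintype V] [Fintype S] [DecidableEq S] in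
/-- Swapping the `W`-coordinates twice is the identity (first component). -/
theorem mixG_mixG_left (W : Finset V) (u w : V → S) : mixG W (mixG W w u) (mixG W u w) = w := by
  funext v
  by_cases hv : v ∈ W
  · rw [mixG_of_mem hv, mixG_of_mem hv]
  · rw [mixG_of_not_mem hv, mixG_of_not_mem hv]

omit [DecidableEq S] in
/-- **Resampling a set of sites**: replacing the coordinates in `W` by an independent copy does not change the
expectation. -/
theorem sum_pw_mixG (m : V → S → ℝ) (hm1 : ∀ v, ∑ s, m v s = 1) (W : Finset V) (F : (V → S) → ℝ) :
    ∑ w, pw m w * F w = ∑ w, pw m w * ∑ u, pw m u * F (mixG W u w) := by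
  have hL : ∑ w, pw m w * F w = ∑ z : (V → S) × (V → S), pw m z.1 * pw m z.2 * F z.1 := by
    rw [Fintype.sum_prod_type]
    refine Finset.sum_congr rfl fun w _ => ?_
    have : ∑ u : V → S, pw m w * pw m u * F w = pw m w * F w * ∑ u : V → S, pw m u := by
      rw [Finset.mul_sum]; exact Finset.sum_congr rfl fun u _ => by ring
    rw [this, sum_pw hm1, mul_one]
  have hR : ∑ w, pw m w * ∑ u, pw m u * F (mixG W u w) =
      ∑ z : (V → S) × (V → S), pw m z.1 * pw m z.2 * F (mixG W z.2 z.1) := by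
    rw [Fintype.sum_prod_type]
    refine Finset.sum_congr rfl fun w _ => ?_
    rw [Finset.mul_sum]
    exact Finset.sum_congr rfl fun u _ => by ring
  rw [hL, hR]
  let θ : (V → S) × (V → S) → (V → S) × (V → S) := fun z => (mixG W z.2 z.1, mixG W z.1 z.2)
  have hθ : Function.Involutive θ := by
    rintro ⟨w, u⟩
    simp only [θ, mixG_mixG_left]
  refine Fintype.sum_equiv hθ.toPerm _ _ fun z => ?_
  obtain ⟨w, u⟩ := z
  change pw m w * pw m u * F w = pw m (mixG W u w) * pw m (mixG W w u) * F (mixG W (mixG W w u) (mixG W u w))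
  rw [mixG_mixG_left, pw_mixG_mul_pw_mixG, mul_comm (pw m u)]

/-! ### Dominance of the fibre sums from per-`w` dominance of the `u`-integral -/

omit [DecidableEq S] in
/-- **Factorised fibres dominate if their `u`-integrals do.**  Suppose the fibre indicator factorises under mixing on
`W` (`T (mixG W u w) ↔ Trest w ∧ Ψ u w`), the payoff `G` on the fibre equals a function `K` of the resampled
coordinates, and for every `w` the `u`-integral of `𝟙[Ψ u w] K u` dominates `E` times the `u`-integral of
`𝟙[Ψ u w]`.  Then `(Σ_{T} pw) · E ≤ Σ_{T} pw · G`. -/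
theorem dominance_of_factorisation (m : V → S → ℝ) (hm1 : ∀ v, ∑ s, m v s = 1) (hm0 : ∀ v s, 0 ≤ m v s)
    (W : Finset V) (T : (V → S) → Prop) [DecidablePred T] (Trest : (V → S) → Prop) [DecidablePred Trest]
    (Ψ : (V → S) → (V → S) → Prop) [∀ u w, Decidable (Ψ u w)] (hfac : ∀ u w, T (mixG W u w) ↔ Trest w ∧ Ψ u w)
    (G K : (V → S) → ℝ) (hG : ∀ u w, Ψ u w → G (mixG W u w) = K u) (E : ℝ)
    (hdom : ∀ w, (∑ u, pw m u * (if Ψ u w then 1 else 0)) * E ≤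
      ∑ u, pw m u * ((if Ψ u w then 1 else 0) * K u)) :
    (∑ w, pw m w * (if T w then (1 : ℝ) else 0)) * E ≤ ∑ w, pw m w * ((if T w then (1 : ℝ) else 0) * G w) := by
  rw [sum_pw_mixG m hm1 W (fun w => if T w then (1 : ℝ) else 0),
    sum_pw_mixG m hm1 W (fun w => (if T w then (1 : ℝ) else 0) * G w)]
  have e1 : ∀ w, ∑ u, pw m u * (if T (mixG W u w) then (1 : ℝ) else 0) =
      (if Trest w then 1 else 0) * ∑ u, pw m u * (if Ψ u w then 1 else 0) := by
    intro w
    rw [Finset.mul_sum]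
    refine Finset.sum_congr rfl fun u _ => ?_
    by_cases h1 : Trest w
    · by_cases h2 : Ψ u w
      · rw [if_pos ((hfac u w).2 ⟨h1, h2⟩), if_pos h1, if_pos h2]; ring
      · rw [if_neg (fun h => h2 ((hfac u w).1 h).2), if_pos h1, if_neg h2]; ring
    · rw [if_neg (fun h => h1 ((hfac u w).1 h).1), if_neg h1]; ring
  have e2 : ∀ w, ∑ u, pw m u * ((if T (mixG W u w) then (1 : ℝ) else 0) * G (mixG W u w)) =
      (if Trest w then 1 else 0) * ∑ u, pw m u * ((if Ψ u w then 1 else 0) * K u) := by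
    intro w
    rw [Finset.mul_sum]
    refine Finset.sum_congr rfl fun u _ => ?_
    by_cases h1 : Trest w
    · by_cases h2 : Ψ u w
      · rw [if_pos ((hfac u w).2 ⟨h1, h2⟩), if_pos h1, if_pos h2, hG u w h2]; ring
      · rw [if_neg (fun h => h2 ((hfac u w).1 h).2), if_pos h1, if_neg h2]; ring
    · rw [if_neg (fun h => h1 ((hfac u w).1 h).1), if_neg h1]; ring
  simp_rw [e1, e2]
  rw [Finset.sum_mul]
  refine Finset.sum_le_sum fun w _ => ?_
  have hw : 0 ≤ pw m w := pw_nonneg hm0 w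
  by_cases h1 : Trest w
  · rw [if_pos h1, one_mul, one_mul, mul_assoc]
    exact mul_le_mul_of_nonneg_left (hdom w) hw
  · rw [if_neg h1]; simp

/-! ### The `u`-integral: resampling `b₂` and `c`, integrating out the failed brothers, law of the reads -/

omit [DecidableEq S] in
/-- **The `u`-integral of the factorised fibre.**  For distinct sites `b₂, c ∉ Bf` and three distinct optional sites
avoiding `b₂, c, Bf`, the integral of `A(u b₂, u c) · D(u c) · Sc(u c) · ∏_{b ∈ Bf} Fb b (u b) (u c) · G(reads)`
(the reads through `φ (u b₂)`) is the explicit double sum over the states `α, γ` of `b₂, c`. -/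
theorem inner_sum_eq (m : V → S → ℝ) (hm1 : ∀ v, ∑ s, m v s = 1) (b₂ c : V) (hcb : c ≠ b₂) (Bf : Finset V)
    (hb₂ : b₂ ∉ Bf) (hc : c ∉ Bf) (o₀ o₁ o₂ : Option V)
    (h01 : ∀ v, o₀ = some v → o₁ ≠ some v) (h02 : ∀ v, o₀ = some v → o₂ ≠ some v)
    (h12 : ∀ v, o₁ = some v → o₂ ≠ some v)
    (hoW : ∀ v, (o₀ = some v ∨ o₁ = some v ∨ o₂ = some v) → v ≠ b₂ ∧ v ≠ c ∧ v ∉ Bf)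
    (A : S → S → ℝ) (D Sc : S → ℝ) (Fb : V → S → S → ℝ) (φ : S → V → S → Bool) (G : Bool → Bool → Bool → ℝ) :
    ∑ u, pw m u * (A (u b₂) (u c) * D (u c) * Sc (u c) * (∏ b ∈ Bf, Fb b (u b) (u c)) *
        G (readB (φ (u b₂)) o₀ u) (readB (φ (u b₂)) o₁ u) (readB (φ (u b₂)) o₂ u)) =
      ∑ α, ∑ γ, m b₂ α * m c γ * A α γ * D γ * Sc γ * (∏ b ∈ Bf, ∑ β, m b β * Fb b β γ) *
        ∑ y0, ∑ y1, ∑ y2, lawB m (φ α) o₀ y0 * lawB m (φ α) o₁ y1 * lawB m (φ α) o₂ y2 * G y0 y1 y2 := by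
  -- reads do not see `b₂`, `c`, `Bf`
  have hr : ∀ (o : Option V), (o = o₀ ∨ o = o₁ ∨ o = o₂) → ∀ (ψ : V → S → Bool) (u : V → S) (v : V) (s : S),
      (v = b₂ ∨ v = c ∨ v ∈ Bf) → readB ψ o (Function.update u v s) = readB ψ o u := by
    intro o ho ψ u v s hv
    apply readB_update_of_ne
    intro hov
    have hv' : o₀ = some v ∨ o₁ = some v ∨ o₂ = some v := by
      rcases ho with rfl | rfl | rfl
      · exact Or.inl hov
      · exact Or.inr (Or.inl hov)
      · exact Or.inr (Or.inr hov)
    obtain ⟨h1, h2, h3⟩ := hoW v hv'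
    rcases hv with rfl | rfl | h
    · exact h1 rfl
    · exact h2 rfl
    · exact h3 h
  -- the reads as a function `R α u`
  set R : S → (V → S) → ℝ := fun α u => G (readB (φ α) o₀ u) (readB (φ α) o₁ u) (readB (φ α) o₂ u) with hR
  have hRupd : ∀ α u v s, (v = b₂ ∨ v = c ∨ v ∈ Bf) → R α (Function.update u v s) = R α u := by
    intro α u v s hv
    simp only [hR, hr o₀ (Or.inl rfl) _ u v s hv, hr o₁ (Or.inr (Or.inl rfl)) _ u v s hv,
      hr o₂ (Or.inr (Or.inr rfl)) _ u v s hv]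
  -- Step 1: resample `b₂`
  have step1 : ∑ u, pw m u * (A (u b₂) (u c) * D (u c) * Sc (u c) * (∏ b ∈ Bf, Fb b (u b) (u c)) * R (u b₂) u) =
      ∑ α, m b₂ α * ∑ u, pw m u * (A α (u c) * D (u c) * Sc (u c) * (∏ b ∈ Bf, Fb b (u b) (u c)) * R α u) := by
    rw [sum_pw_resample m hm1 b₂]
    have : ∀ u : V → S, ∑ s, m b₂ s * (A (Function.update u b₂ s b₂) (Function.update u b₂ s c) *
        D (Function.update u b₂ s c) * Sc (Function.update u b₂ s c) *
        (∏ b ∈ Bf, Fb b (Function.update u b₂ s b) (Function.update u b₂ s c)) *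
        R (Function.update u b₂ s b₂) (Function.update u b₂ s)) =
        ∑ s, m b₂ s * (A s (u c) * D (u c) * Sc (u c) * (∏ b ∈ Bf, Fb b (u b) (u c)) * R s u) := by
      intro u
      refine Finset.sum_congr rfl fun s _ => ?_
      rw [Function.update_self, Function.update_of_ne hcb, hRupd s u b₂ s (Or.inl rfl)]
      congr 3
      exact Finset.prod_congr rfl fun b hb => by rw [Function.update_of_ne (ne_of_mem_of_not_mem hb hb₂)]
    simp_rw [this, Finset.mul_sum]
    rw [Finset.sum_comm]
    exact Finset.sum_congr rfl fun α _ => Finset.sum_congr rfl fun u _ => by ring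
  -- Step 2: resample `c`, for fixed `α`
  have step2 : ∀ α, ∑ u, pw m u * (A α (u c) * D (u c) * Sc (u c) * (∏ b ∈ Bf, Fb b (u b) (u c)) * R α u) =
      ∑ γ, m c γ * A α γ * D γ * Sc γ * ∑ u, pw m u * ((∏ b ∈ Bf, Fb b (u b) γ) * R α u) := by
    intro α
    rw [sum_pw_resample m hm1 c]
    have : ∀ u : V → S, ∑ s, m c s * (A α (Function.update u c s c) * D (Function.update u c s c) *
        Sc (Function.update u c s c) * (∏ b ∈ Bf, Fb b (Function.update u c s b) (Function.update u c s c)) *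
        R α (Function.update u c s)) =
        ∑ s, m c s * (A α s * D s * Sc s * (∏ b ∈ Bf, Fb b (u b) s) * R α u) := by
      intro u
      refine Finset.sum_congr rfl fun s _ => ?_
      rw [Function.update_self, hRupd α u c s (Or.inr (Or.inl rfl))]
      congr 3
      exact Finset.prod_congr rfl fun b hb => by rw [Function.update_of_ne (ne_of_mem_of_not_mem hb hc)]
    simp_rw [this, Finset.mul_sum]
    rw [Finset.sum_comm]
    exact Finset.sum_congr rfl fun γ _ => Finset.sum_congr rfl fun u _ => by ring
  -- Step 3: integrate out the failed brothers, then the reads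
  have step3 : ∀ α γ, ∑ u, pw m u * ((∏ b ∈ Bf, Fb b (u b) γ) * R α u) =
      (∏ b ∈ Bf, ∑ β, m b β * Fb b β γ) *
        ∑ y0, ∑ y1, ∑ y2, lawB m (φ α) o₀ y0 * lawB m (φ α) o₁ y1 * lawB m (φ α) o₂ y2 * G y0 y1 y2 := by
    intro α γ
    rw [sum_pw_mul_prod_blind m hm1 Bf (fun b s => Fb b s γ) (R α)
      (fun u v hv s => hRupd α u v s (Or.inr (Or.inr hv)))]
    congr 1
    exact sum_pw_read3 m hm1 (φ α) o₀ o₁ o₂ h01 h02 h12 G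
  rw [step1]
  refine Finset.sum_congr rfl fun α _ => ?_
  rw [step2 α, Finset.mul_sum]
  refine Finset.sum_congr rfl fun γ _ => ?_
  rw [step3 α γ]
  ring

/-! ### The `π_q`-side: a step test function reads only its three sites -/

/-- The canonical configuration with the values `y0, y1, y2` at three optional sites and `false` elsewhere. -/
def xOf (o₀ o₁ o₂ : Option V) (y0 y1 y2 : Bool) : V → Bool := fun v =>
  if o₀ = some v then y0 else if o₁ = some v then y1 else if o₂ = some v then y2 else false

omit [Fintype V] in
/-- `xOf` is monotone in the three values. -/
theorem xOf_mono (o₀ o₁ o₂ : Option V) {y0 y1 y2 y0' y1' y2' : Bool} (h0 : y0 ≤ y0') (h1 : y1 ≤ y1')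
    (h2 : y2 ≤ y2') (v : V) : xOf o₀ o₁ o₂ y0 y1 y2 v ≤ xOf o₀ o₁ o₂ y0' y1' y2' v := by
  unfold xOf; split_ifs <;> first | exact h0 | exact h1 | exact h2 | exact le_rfl

omit [Fintype V] in
/-- `xOf` ignores the value at an absent first site. -/
theorem xOf_congr₀ {o₀ o₁ o₂ : Option V} (h : o₀ = none) (y0 y0' y1 y2 : Bool) :
    xOf o₀ o₁ o₂ y0 y1 y2 = xOf o₀ o₁ o₂ y0' y1 y2 := by
  funext v; unfold xOf; rw [h]; simp

omit [Fintype V] in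
/-- `xOf` ignores the value at an absent second site. -/
theorem xOf_congr₁ {o₀ o₁ o₂ : Option V} (h : o₁ = none) (y0 y1 y1' y2 : Bool) :
    xOf o₀ o₁ o₂ y0 y1 y2 = xOf o₀ o₁ o₂ y0 y1' y2 := by
  funext v; unfold xOf; rw [h]; simp

omit [Fintype V] in
/-- `xOf` ignores the value at an absent third site. -/
theorem xOf_congr₂ {o₀ o₁ o₂ : Option V} (h : o₂ = none) (y0 y1 y2 y2' : Bool) :
    xOf o₀ o₁ o₂ y0 y1 y2 = xOf o₀ o₁ o₂ y0 y1 y2' := by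
  funext v; unfold xOf; rw [h]; simp

omit [Fintype V] [Fintype S] [DecidableEq S] in
/-- At a present site, `xOf` takes the prescribed value (for distinct sites). -/
theorem xOf_apply_of_reads {o₀ o₁ o₂ : Option V} (h01 : ∀ v, o₀ = some v → o₁ ≠ some v)
    (h02 : ∀ v, o₀ = some v → o₂ ≠ some v) (h12 : ∀ v, o₁ = some v → o₂ ≠ some v)
    (ψ : V → S → Bool) (u : V → S) {v : V} (hv : o₀ = some v ∨ o₁ = some v ∨ o₂ = some v) :
    xOf o₀ o₁ o₂ (readB ψ o₀ u) (readB ψ o₁ u) (readB ψ o₂ u) v = ψ v (u v) := by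
  unfold xOf
  rcases hv with h | h | h
  · rw [if_pos h, h]; rfl
  · have h0 : o₀ ≠ some v := fun h0 => h01 v h0 h
    rw [if_neg h0, if_pos h, h]; rfl
  · have h0 : o₀ ≠ some v := fun h0 => h02 v h0 h
    have h1 : o₁ ≠ some v := fun h1 => h12 v h1 h
    rw [if_neg h0, if_neg h1, if_pos h, h]; rfl

omit [Fintype V] in
/-- **A step test function composed with `xOf` is monotone on `Bool³`.** -/
theorem monotone_comp_xOf {C : Finset V} {g : (V → Bool) → ℝ} (hg : StepTest C g) (o₀ o₁ o₂ : Option V) :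
    Monotone (fun y : Bool × Bool × Bool => g (xOf o₀ o₁ o₂ y.1 y.2.1 y.2.2)) := by
  rintro ⟨y0, y1, y2⟩ ⟨y0', y1', y2'⟩ h
  simp only [Prod.mk_le_mk] at h
  exact hg.1 _ _ fun v _ => xOf_mono o₀ o₁ o₂ h.1 h.2.1 h.2.2 v

/-- **The `π_q`-expectation of a step test function reading only three optional sites** (covering its examined set
`C`) is the `π_q^{⊗3}`-expectation of `g ∘ xOf`. -/
theorem sum_wt_eq_sum_pi3 {C : Finset V} {g : (V → Bool) → ℝ} (hg : StepTest C g) (o₀ o₁ o₂ : Option V)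
    (h01 : ∀ v, o₀ = some v → o₁ ≠ some v) (h02 : ∀ v, o₀ = some v → o₂ ≠ some v)
    (h12 : ∀ v, o₁ = some v → o₂ ≠ some v) (hC : ∀ v ∈ C, o₀ = some v ∨ o₁ = some v ∨ o₂ = some v) :
    ∑ ω : V → Bool, wt (556 / 1000) ω * g ω =
      ∑ y : Bool × Bool × Bool, pi3 y * g (xOf o₀ o₁ o₂ y.1 y.2.1 y.2.2) := by
  set ψ : V → Bool → Bool := fun _ b => b with hψ
  set mq : V → Bool → ℝ := fun _ b => bern (556 / 1000) b with hmq
  have hmq1 : ∀ v, ∑ b, mq v b = 1 := fun v => sum_bern _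
  have hwt : ∀ ω : V → Bool, wt (556 / 1000) ω = pw mq ω := fun ω => rfl
  -- `g` reads only the three sites
  have hread : ∀ ω : V → Bool, g ω = g (xOf o₀ o₁ o₂ (readB ψ o₀ ω) (readB ψ o₁ ω) (readB ψ o₂ ω)) := by
    intro ω
    refine hg.2 _ _ fun v hv => ?_
    rw [xOf_apply_of_reads h01 h02 h12 ψ ω (hC v hv)]
  have hL : ∑ ω : V → Bool, wt (556 / 1000) ω * g ω =
      ∑ ω : V → Bool, pw mq ω * (fun y0 y1 y2 => g (xOf o₀ o₁ o₂ y0 y1 y2))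
        (readB ψ o₀ ω) (readB ψ o₁ ω) (readB ψ o₂ ω) :=
    Finset.sum_congr rfl fun ω _ => by rw [hwt ω]; exact congrArg (pw mq ω * ·) (hread ω)
  rw [hL, sum_pw_read3 mq hmq1 ψ o₀ o₁ o₂ h01 h02 h12 (fun y0 y1 y2 => g (xOf o₀ o₁ o₂ y0 y1 y2))]
  -- replace the law of every absent read by `bern q`
  have hpres : ∀ o : Option V, o ≠ none → lawB mq ψ o = fun b => bern (556 / 1000) b := by
    intro o ho
    obtain ⟨v, rfl⟩ := Option.ne_none_iff_exists'.1 ho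
    funext b
    have hf : univ.filter (fun s => ψ v s = b) = {b} := by ext s; simp [hψ]
    simp only [lawB]
    rw [hf, Finset.sum_singleton]
  have hq1 : ∑ b, (fun b => bern (556 / 1000 : ℝ) b) b = 1 := sum_bern _
  have e0 : ∑ y0, ∑ y1, ∑ y2, lawB mq ψ o₀ y0 * lawB mq ψ o₁ y1 * lawB mq ψ o₂ y2 * g (xOf o₀ o₁ o₂ y0 y1 y2) =
      ∑ y0, ∑ y1, ∑ y2, bern (556 / 1000) y0 * lawB mq ψ o₁ y1 * lawB mq ψ o₂ y2 * g (xOf o₀ o₁ o₂ y0 y1 y2) := by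
    by_cases h : o₀ = none
    · exact sum_law3_congr_fst _ _ _ _ (sum_lawB mq hmq1 ψ o₀) hq1 _ fun y1 y2 => by rw [xOf_congr₀ h]
    · rw [hpres o₀ h]
  have e1 : ∑ y0, ∑ y1, ∑ y2, bern (556 / 1000) y0 * lawB mq ψ o₁ y1 * lawB mq ψ o₂ y2 * g (xOf o₀ o₁ o₂ y0 y1 y2) =
      ∑ y0, ∑ y1, ∑ y2, bern (556 / 1000) y0 * bern (556 / 1000) y1 * lawB mq ψ o₂ y2 *
        g (xOf o₀ o₁ o₂ y0 y1 y2) := by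
    by_cases h : o₁ = none
    · exact sum_law3_congr_snd _ _ _ _ (sum_lawB mq hmq1 ψ o₁) hq1 _ fun y0 y2 => by rw [xOf_congr₁ h]
    · rw [hpres o₁ h]
  have e2 : ∑ y0, ∑ y1, ∑ y2, bern (556 / 1000) y0 * bern (556 / 1000) y1 * lawB mq ψ o₂ y2 *
        g (xOf o₀ o₁ o₂ y0 y1 y2) =
      ∑ y0, ∑ y1, ∑ y2, bern (556 / 1000) y0 * bern (556 / 1000) y1 * bern (556 / 1000) y2 *
        g (xOf o₀ o₁ o₂ y0 y1 y2) := by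
    by_cases h : o₂ = none
    · exact sum_law3_congr_thd _ _ _ _ (sum_lawB mq hmq1 ψ o₂) hq1 _ fun y0 y1 => by rw [xOf_congr₂ h]
    · rw [hpres o₂ h]
  rw [e0, e1, e2, Fintype.sum_prod_type]
  refine Finset.sum_congr rfl fun y0 _ => ?_
  rw [Fintype.sum_prod_type]
  refine Finset.sum_congr rfl fun y1 _ => Finset.sum_congr rfl fun y2 _ => ?_
  simp only [pi3]

end AdaptDom

end Summit.CriticalPhenomena.PercolationContinuityZ3.Theorems.Pcint
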